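import Summits.AtomisticToContinuum.Crystallization.Theorems.FrustratedLawDichotomyThickeningStability
import Summits.AtomisticToContinuum.Crystallization.Theorems.FrustratedLawDichotomyTransportPrice

/-!
# FrustratedLawDichotomy · crux `AperiodicFrustratedLawGap` (stmt-AtomisticToContinuum-27623) — COVARIANT THICKENING OF LAWS, part 3:
# the Mecke-symmetrised insertion price — THE MEAN FIELD AT PATTERN-SELECTED HOLES OF A MINIMISING LAW IS AT LEAST `e⋆`
# (decomp-a2c, prover hand 2, structural share, generation 4)

In `thickening_stability` / `insertionPrice_of_minimising` (part 2) the old root's view of the inserted atoms, `½ Σ_{p∈K} V_LJ(‖p+u‖)`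
(`K = {p : θ_p μ ∈ A}`), and the inserted root's view of the old configuration, `½ Φ_μ(u) = ½ Σ_q V_LJ(‖q−u‖)`, have THE SAME MEAN by the Mecke /
mass-transport identity (`integral_crossField_eq`: root `0` sends `V_LJ(‖p+u‖)` to each pattern atom `p`; written with the Bochner form
`FrustratedLawDichotomyTransportPrice.integral_inflow_toReal_eq` on the positive and negative parts).  Hence the SYMMETRISED INSERTION PRICE of
a minimising law (`meanField_ge_of_minimising`):

  `P(A)·e⋆ ≤ ∫_A Φ_μ(u) dP(μ) + ½ ∫_A Σ_{p∈K} V_LJ(‖p‖) dP(μ)`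

for every Giry-measurable pattern `A` and offset `u` with almost surely `s`-vacant inserted sites: CONDITIONALLY ON THE PATTERN, THE MEAN
LENNARD-JONES FIELD AT THE SELECTED HOLE IS AT LEAST `e⋆`, up to half the mutual energy of the pattern atoms (non-positive as soon as the pattern
atoms are `≥ 2^{-1/6}` apart, and in general at most the root's short-range repulsion `½ Σ_{q≠0} V_LJ⁺(‖q‖)` — the pointwise vacancy floor of the
sequel).  All `[folklore]`.
-/

noncomputable section

namespace Summit.AtomisticToContinuum.Crystallization.Theorems.FrustratedLawDichotomyThickening

open MeasureTheory Metric Set Filter ProbabilityTheory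
open scoped ENNReal Topology BigOperators
open Literature.MathematicalPhysics.StatisticalMechanics Literature.Probability.Process
open Summit.AtomisticToContinuum.Crystallization.Theorems.ChargedEnergyGapNegative (E3 eStar)
open Summit.AtomisticToContinuum.Crystallization.Theorems.BenjaminiSchrammLimit (measurableSet_setOf_isRootedHardCore)
open Summit.AtomisticToContinuum.Crystallization.Theorems.FrustratedLawDichotomyFiniteClusterGap
  (ae_mem_of_sep exists_kernel_eq_count_restrict measurable_kernel_map_sub measurable_ofReal_lennardJones_parts
    lintegral_lennardJones_parts_map_sub_le integrable_rootEnergy_of_ae_hardCore)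
open Summit.AtomisticToContinuum.Crystallization.Theorems.FrustratedLawDichotomyThinning (map_sub_map_sub_neg)
open Summit.AtomisticToContinuum.Crystallization.Theorems.FrustratedLawDichotomyTransportPrice (integral_inflow_toReal_eq
  lintegral_outflow_ne_top_of_bound)

variable {δ : ℝ} {A : Set (Measure E3)} {P : Measure (Measure E3)}

/-! ## §1. Shell bounds for the cross field -/

/-- **The old root's view of the inserted atoms is shell-bounded**: for a rooted `δ`-hard-core `μ` with `s`-vacant inserted sites, the positive
and negative parts of `Σ_{p∈K} V_LJ(‖p+u‖)` are bounded by the shell bounds of the (rooted `min δ s`-hard-core) thickened configuration.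
[folklore] -/
theorem lintegral_crossField_parts_le (hδ : 0 < δ) {s : ℝ} (hs : 0 < s) {μ : Measure E3} (hμ : IsRootedHardCore δ μ)
    (hK : MeasurableSet {p : E3 | μ.map (fun x : E3 => x - p) ∈ A}) {u : E3}
    (hV : ∀ p q : E3, μ {p} ≠ 0 → μ {q} ≠ 0 → μ.map (fun x : E3 => x - p) ∈ A → s ≤ dist q (p + u)) :
    ∫⁻ z, ENNReal.ofReal (lennardJones ‖z + u‖) ∂(μ.restrict {p : E3 | μ.map (fun x : E3 => x - p) ∈ A}) ≤
        ENNReal.ofReal (250 / 12 * (min δ s)⁻¹ ^ 12) ∧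
      ∫⁻ z, ENNReal.ofReal (-lennardJones ‖z + u‖) ∂(μ.restrict {p : E3 | μ.map (fun x : E3 => x - p) ∈ A}) ≤
        ENNReal.ofReal (250 / 6 * (min δ s)⁻¹ ^ 6) := by
  obtain ⟨T, h0T, hsepT, hT⟩ := isRootedHardCore_ins hδ hs hμ hK hV
  obtain ⟨hp, hm⟩ := measurable_ofReal_lennardJones_parts
  have hb := lintegral_lennardJones_parts_map_sub_le (lt_min hδ hs) hsepT h0T
  simp only [sub_zero, Measure.map_id'] at hb
  rw [← hT] at hb
  constructor
  · calc ∫⁻ z, ENNReal.ofReal (lennardJones ‖z + u‖) ∂(μ.restrict {p : E3 | μ.map (fun x : E3 => x - p) ∈ A})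
        = ∫⁻ z, ENNReal.ofReal (lennardJones ‖z‖) ∂((μ.restrict {p : E3 | μ.map (fun x : E3 => x - p) ∈ A}).map (fun z => z + u)) :=
          (lintegral_map hp (measurable_add_const u)).symm
      _ ≤ ∫⁻ z, ENNReal.ofReal (lennardJones ‖z‖) ∂(μ + (μ.restrict {p : E3 | μ.map (fun x : E3 => x - p) ∈ A}).map (fun z => z + u)) :=
          lintegral_mono' (Measure.le_add_left le_rfl) le_rfl
      _ ≤ _ := hb.1
  · calc ∫⁻ z, ENNReal.ofReal (-lennardJones ‖z + u‖) ∂(μ.restrict {p : E3 | μ.map (fun x : E3 => x - p) ∈ A})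
        = ∫⁻ z, ENNReal.ofReal (-lennardJones ‖z‖) ∂((μ.restrict {p : E3 | μ.map (fun x : E3 => x - p) ∈ A}).map (fun z => z + u)) :=
          (lintegral_map hm (measurable_add_const u)).symm
      _ ≤ ∫⁻ z, ENNReal.ofReal (-lennardJones ‖z‖) ∂(μ + (μ.restrict {p : E3 | μ.map (fun x : E3 => x - p) ∈ A}).map (fun z => z + u)) :=
          lintegral_mono' (Measure.le_add_left le_rfl) le_rfl
      _ ≤ _ := hb.2

/-! ## §2. The Mecke swap: both views of the insertion have the same mean -/

/-- **THE CROSS FIELD AND THE HOLE FIELD HAVE THE SAME MEAN.**  For a point-stationary `δ`-hard-core probability law, a Giry-measurable pattern `A`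
and an offset `u` with almost surely `s`-vacant inserted sites:
`E_P[rootEnergy(Ins μ)] − E_P[rootEnergy μ] = ½ ∫_A Φ_μ(u) dP`, `Φ_μ(u) = ∫ V_LJ(‖q − u‖) dμ(q)` — the root sends `V_LJ(‖p+u‖)` to every pattern
atom `p` (Mecke identity on the positive and negative parts); and `1_A · Φ_·(u)` is integrable. [folklore] -/
theorem integral_crossField_eq (hδ : 0 < δ) {s : ℝ} (hs : 0 < s) [IsProbabilityMeasure P] (hcore : ∀ᵐ μ ∂P, IsRootedHardCore δ μ)
    (hstat : IsPointStationaryLaw P) (hA : MeasurableSet A) (u : E3)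
    (hV : ∀ᵐ μ ∂P, ∀ p q : E3, μ {p} ≠ 0 → μ {q} ≠ 0 → μ.map (fun x : E3 => x - p) ∈ A → s ≤ dist q (p + u)) :
    Integrable (fun μ => A.indicator (fun μ => ∫ z, lennardJones ‖z - u‖ ∂μ) μ) P ∧
    Integrable (fun μ => rootEnergy lennardJones (μ + (μ.restrict {p : E3 | μ.map (fun x : E3 => x - p) ∈ A}).map (fun z => z + u))) P ∧
    (∫ μ, rootEnergy lennardJones (μ + (μ.restrict {p : E3 | μ.map (fun x : E3 => x - p) ∈ A}).map (fun z => z + u)) ∂P) -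
        ∫ μ, rootEnergy lennardJones μ ∂P = (∫ μ in A, ∫ z, lennardJones ‖z - u‖ ∂μ ∂P) / 2 := by
  classical
  have hδ' : 0 < min δ s := lt_min hδ hs
  obtain ⟨I, hIm, hI⟩ := exists_measurable_ins (A := A) hδ hA u
  -- kernelised pattern relation
  obtain ⟨κ, hκs, hκ⟩ := exists_kernel_eq_count_restrict hδ
  have hκid : ∀ μ : Measure E3, IsRootedHardCore δ μ → κ μ = μ := by
    rintro μ ⟨S, -, hsep, rfl⟩; exact hκ S hsep
  set B : Set (Measure E3 × E3) := (fun q : Measure E3 × E3 => (κ q.1).map fun z => z - q.2) ⁻¹' A with hBdef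
  have hB : MeasurableSet B := measurable_kernel_map_sub κ hA
  have hsec : ∀ μ : Measure E3, IsRootedHardCore δ μ → ∀ y : E3,
      ((μ, y) ∈ B ↔ y ∈ {p : E3 | μ.map (fun x : E3 => x - p) ∈ A}) := fun μ hμ y => by
    simp only [hBdef, Set.mem_preimage, Set.mem_setOf_eq, hκid μ hμ]
  obtain ⟨hp, hm⟩ := measurable_ofReal_lennardJones_parts
  -- the two transports (positive and negative parts of the cross field)
  set Fp : Measure E3 → E3 → ℝ≥0∞ := fun μ y => B.indicator (fun _ => (1 : ℝ≥0∞)) (μ, y) * ENNReal.ofReal (lennardJones ‖y + u‖) with hFp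
  set Fm : Measure E3 → E3 → ℝ≥0∞ := fun μ y => B.indicator (fun _ => (1 : ℝ≥0∞)) (μ, y) * ENNReal.ofReal (-lennardJones ‖y + u‖) with hFm
  have h1B : Measurable fun q : Measure E3 × E3 => B.indicator (fun _ => (1 : ℝ≥0∞)) q := measurable_const.indicator hB
  have hFpm : Measurable (Function.uncurry Fp) := h1B.mul (hp.comp (measurable_snd.add_const u))
  have hFmm : Measurable (Function.uncurry Fm) := h1B.mul (hm.comp (measurable_snd.add_const u))
  -- out-flows on hard-core configurations
  have hout : ∀ μ : Measure E3, IsRootedHardCore δ μ → ∀ (f : E3 → ℝ≥0∞), Measurable f →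
      ∫⁻ y, B.indicator (fun _ => (1 : ℝ≥0∞)) (μ, y) * f y ∂μ = ∫⁻ y, f y ∂(μ.restrict {p : E3 | μ.map (fun x : E3 => x - p) ∈ A}) := by
    intro μ hμ f hf
    rw [← lintegral_indicator (hI μ hμ).1]
    refine lintegral_congr fun y => ?_
    by_cases hy : y ∈ {p : E3 | μ.map (fun x : E3 => x - p) ∈ A}
    · rw [Set.indicator_of_mem ((hsec μ hμ y).2 hy), Set.indicator_of_mem hy, one_mul]
    · rw [Set.indicator_of_notMem (fun h => hy ((hsec μ hμ y).1 h)), Set.indicator_of_notMem hy, zero_mul]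
  -- in-flows on hard-core configurations
  have hin : ∀ μ : Measure E3, IsRootedHardCore δ μ → ∀ (f : E3 → ℝ≥0∞), Measurable f →
      ∫⁻ y, B.indicator (fun _ => (1 : ℝ≥0∞)) (μ.map (fun z => z - y), -y) * f (-y + u) ∂μ =
        A.indicator (fun _ => (1 : ℝ≥0∞)) μ * ∫⁻ y, f (-y + u) ∂μ := by
    intro μ hμ f hf
    have hμ' := hμ
    obtain ⟨S, h0S, hsep, rfl⟩ := hμ
    rw [← lintegral_const_mul _ (show Measurable (fun y : E3 => f (-y + u)) from hf.comp (measurable_neg.add_const u))]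
    refine lintegral_congr_ae ((ae_mem_of_sep hδ hsep).mono fun y hy => ?_)
    have hy' : (Measure.count : Measure E3).restrict S {y} ≠ 0 := (count_restrict_singleton_ne_zero_iff S y).2 hy
    have hmem : ((((Measure.count : Measure E3).restrict S).map fun z : E3 => z - y), -y) ∈ B ↔
        (Measure.count : Measure E3).restrict S ∈ A := by
      rw [hsec _ (hμ'.map_sub hy') (-y), Set.mem_setOf_eq, map_sub_map_sub_neg]
    dsimp only
    by_cases h : (Measure.count : Measure E3).restrict S ∈ A
    · rw [Set.indicator_of_mem (hmem.2 h), Set.indicator_of_mem h]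
    · rw [Set.indicator_of_notMem (fun h' => h (hmem.1 h')), Set.indicator_of_notMem h]
  -- finite mean out-flows (shell bounds)
  have hbp : ∫⁻ μ, ∫⁻ y, Fp μ y ∂μ ∂P ≠ ∞ := by
    refine lintegral_outflow_ne_top_of_bound (C := ENNReal.ofReal (250 / 12 * (min δ s)⁻¹ ^ 12)) ENNReal.ofReal_ne_top ?_
    filter_upwards [hcore, hV] with μ hμ hμV
    simp only [hFp]
    rw [hout μ hμ (fun y : E3 => ENNReal.ofReal (lennardJones ‖y + u‖)) (hp.comp (measurable_add_const u))]
    exact (lintegral_crossField_parts_le hδ hs hμ (hI μ hμ).1 hμV).1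
  have hbm : ∫⁻ μ, ∫⁻ y, Fm μ y ∂μ ∂P ≠ ∞ := by
    refine lintegral_outflow_ne_top_of_bound (C := ENNReal.ofReal (250 / 6 * (min δ s)⁻¹ ^ 6)) ENNReal.ofReal_ne_top ?_
    filter_upwards [hcore, hV] with μ hμ hμV
    simp only [hFm]
    rw [hout μ hμ (fun y : E3 => ENNReal.ofReal (-lennardJones ‖y + u‖)) (hm.comp (measurable_add_const u))]
    exact (lintegral_crossField_parts_le hδ hs hμ (hI μ hμ).1 hμV).2
  obtain ⟨-, -, hIop, hIip, heqp⟩ := integral_inflow_toReal_eq hδ hcore hstat hFpm hbp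
  obtain ⟨-, -, hIom, hIim, heqm⟩ := integral_inflow_toReal_eq hδ hcore hstat hFmm hbm
  -- a.e. identification of the out-flow difference with `2 (rootEnergy (Ins μ) − rootEnergy μ)`
  have hout_ae : ∀ᵐ μ ∂P, (∫⁻ y, Fp μ y ∂μ).toReal - (∫⁻ y, Fm μ y ∂μ).toReal =
      2 * (rootEnergy lennardJones (μ + (μ.restrict {p : E3 | μ.map (fun x : E3 => x - p) ∈ A}).map (fun z => z + u)) -
        rootEnergy lennardJones μ) := by
    filter_upwards [hcore, hV] with μ hμ hμV
    obtain ⟨hintu, hE⟩ := rootEnergy_ins hδ hs hμ (hI μ hμ).1 hμV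
    simp only [hFp, hFm]
    rw [hout μ hμ (fun y : E3 => ENNReal.ofReal (lennardJones ‖y + u‖)) (hp.comp (measurable_add_const u)),
      hout μ hμ (fun y : E3 => ENNReal.ofReal (-lennardJones ‖y + u‖)) (hm.comp (measurable_add_const u)),
      ← integral_eq_lintegral_pos_part_sub_lintegral_neg_part hintu, hE]
    ring
  -- a.e. identification of the in-flow difference with `1_A · Φ_μ(u)`
  have hin_ae : ∀ᵐ μ ∂P, (∫⁻ y, Fp (μ.map fun z => z - y) (-y) ∂μ).toReal - (∫⁻ y, Fm (μ.map fun z => z - y) (-y) ∂μ).toReal =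
      A.indicator (fun μ => ∫ z, lennardJones ‖z - u‖ ∂μ) μ := by
    filter_upwards [hcore, hV] with μ hμ hμV
    simp only [hFp, hFm]
    rw [hin μ hμ _ hp, hin μ hμ _ hm]
    by_cases hμA : μ ∈ A
    · obtain ⟨hintv, -, -⟩ := rootEnergy_ins_copy hδ hs hμ (hI μ hμ).1 hμV hμA
      simp only [Set.indicator_of_mem hμA, one_mul]
      have e1 : (fun y : E3 => ENNReal.ofReal (lennardJones ‖-y + u‖)) = fun y : E3 => ENNReal.ofReal (lennardJones ‖y - u‖) := by
        funext y; rw [show -y + u = -(y - u) by abel, norm_neg]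
      have e2 : (fun y : E3 => ENNReal.ofReal (-lennardJones ‖-y + u‖)) = fun y : E3 => ENNReal.ofReal (-lennardJones ‖y - u‖) := by
        funext y; rw [show -y + u = -(y - u) by abel, norm_neg]
      rw [e1, e2, ← integral_eq_lintegral_pos_part_sub_lintegral_neg_part hintv]
    · simp only [Set.indicator_of_notMem hμA, zero_mul, ENNReal.toReal_zero, sub_zero]
  -- integrability of `rootEnergy ∘ Ins`
  have hcoreI : ∀ᵐ ν ∂(P.map I), IsRootedHardCore (min δ s) ν := ae_isRootedHardCore_thickened hδ hs hcore u hV hIm hI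
  haveI : IsFiniteMeasure (P.map I) := ⟨by rw [Measure.map_apply hIm MeasurableSet.univ, Set.preimage_univ]; exact measure_lt_top P _⟩
  have hintI0 : Integrable (fun ν => rootEnergy lennardJones ν) (P.map I) := integrable_rootEnergy_of_ae_hardCore hδ' hcoreI
  have hintI : Integrable (fun μ => rootEnergy lennardJones (μ + (μ.restrict {p : E3 | μ.map (fun x : E3 => x - p) ∈ A}).map (fun z => z + u))) P :=
    ((integrable_map_measure hintI0.aestronglyMeasurable hIm.aemeasurable).1 hintI0).congr
      (hcore.mono fun μ hμ => by show rootEnergy lennardJones (I μ) = _; rw [(hI μ hμ).2])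
  have hintE : Integrable (fun μ => rootEnergy lennardJones μ) P := integrable_rootEnergy_of_ae_hardCore hδ hcore
  refine ⟨(hIip.sub hIim).congr hin_ae, hintI, ?_⟩
  have h1 : ∫ μ, A.indicator (fun μ => ∫ z, lennardJones ‖z - u‖ ∂μ) μ ∂P =
      ∫ μ, ((∫⁻ y, Fp (μ.map fun z => z - y) (-y) ∂μ).toReal - (∫⁻ y, Fm (μ.map fun z => z - y) (-y) ∂μ).toReal) ∂P :=
    (integral_congr_ae hin_ae).symm
  have h2 : ∫ μ, (2 * (rootEnergy lennardJones (μ + (μ.restrict {p : E3 | μ.map (fun x : E3 => x - p) ∈ A}).map (fun z => z + u)) -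
        rootEnergy lennardJones μ)) ∂P = ∫ μ, ((∫⁻ y, Fp μ y ∂μ).toReal - (∫⁻ y, Fm μ y ∂μ).toReal) ∂P :=
    (integral_congr_ae hout_ae).symm
  rw [← integral_indicator hA, h1, integral_sub hIip hIim, heqp, heqm, ← integral_sub hIop hIom, ← h2, integral_const_mul,
    integral_sub hintI hintE]
  ring

/-! ## §3. The symmetrised insertion price of a minimising law -/

/-- **THE MEAN FIELD AT PATTERN-SELECTED HOLES IS AT LEAST `e⋆`.**  Granted the floor of item 9229 (`hU`): for a MINIMISING point-stationary
`δ`-hard-core probability law (`E_P[rootEnergy] ≤ e⋆`), every Giry-measurable pattern `A` and offset `u` with almost surely `s`-vacant inserted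
sites, `P(A)·e⋆ ≤ ∫_A Φ_μ(u) dP + ½ ∫_A Σ_{p∈K} V_LJ(‖p‖) dP` (`K = {p : θ_p μ ∈ A}`; the root's own term vanishes, `V_LJ(0) = 0`). [folklore] -/
theorem meanField_ge_of_minimising
    (hU : ∀ δ' : ℝ, 0 < δ' → ∀ Q : Measure (Measure E3), IsProbabilityMeasure Q → (∀ᵐ μ ∂Q, IsRootedHardCore δ' μ) →
      IsPointStationaryLaw Q → eStar ≤ ∫ μ, rootEnergy lennardJones μ ∂Q)
    (hδ : 0 < δ) {s : ℝ} (hs : 0 < s) [IsProbabilityMeasure P] (hcore : ∀ᵐ μ ∂P, IsRootedHardCore δ μ) (hstat : IsPointStationaryLaw P)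
    (hA : MeasurableSet A) (u : E3)
    (hV : ∀ᵐ μ ∂P, ∀ p q : E3, μ {p} ≠ 0 → μ {q} ≠ 0 → μ.map (fun x : E3 => x - p) ∈ A → s ≤ dist q (p + u))
    (hE : ∫ μ, rootEnergy lennardJones μ ∂P ≤ eStar) :
    Integrable (fun μ => ∫ z, lennardJones ‖z‖ ∂(μ.restrict {p : E3 | μ.map (fun x : E3 => x - p) ∈ A})) (P.restrict A) ∧
    (P A).toReal * eStar ≤ (∫ μ in A, ∫ z, lennardJones ‖z - u‖ ∂μ ∂P) +
      (∫ μ in A, ∫ z, lennardJones ‖z‖ ∂(μ.restrict {p : E3 | μ.map (fun x : E3 => x - p) ∈ A}) ∂P) / 2 := by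
  have hδ' : 0 < min δ s := lt_min hδ hs
  have hprice := insertionPrice_of_minimising hU hδ hs hcore hstat hA u hV hE
  obtain ⟨hintΦ, -, hswap⟩ := integral_crossField_eq hδ hs hcore hstat hA u hV
  rw [hswap] at hprice
  -- the copy-rooted energy on `A`, unpacked
  obtain ⟨I, hIm, hI⟩ := exists_measurable_ins (A := A) hδ hA u
  set J : Measure E3 → Measure E3 := fun μ => (I μ).map (fun z => z - u) with hJdef
  have hJm : Measurable J := (Measure.measurable_map _ (measurable_sub_const u)).comp hIm
  have hcoreJ : ∀ᵐ ν ∂((P.restrict A).map J), IsRootedHardCore (min δ s) ν :=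
    ae_isRootedHardCore_thickened_copy hδ hs hcore hA u hV hIm hI
  haveI : IsFiniteMeasure ((P.restrict A).map J) :=
    ⟨by rw [Measure.map_apply hJm MeasurableSet.univ, Set.preimage_univ]; exact measure_lt_top _ _⟩
  have hintJ0 : Integrable (fun ν => rootEnergy lennardJones ν) ((P.restrict A).map J) := integrable_rootEnergy_of_ae_hardCore hδ' hcoreJ
  have hcopy_ae : ∀ᵐ μ ∂(P.restrict A), rootEnergy lennardJones (J μ) =
      (∫ z, lennardJones ‖z - u‖ ∂μ) / 2 + (∫ z, lennardJones ‖z‖ ∂(μ.restrict {p : E3 | μ.map (fun x : E3 => x - p) ∈ A})) / 2 := by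
    filter_upwards [ae_restrict_of_ae (s := A) hcore, ae_restrict_of_ae (s := A) hV, ae_restrict_mem hA] with μ hμ hμV hμA
    obtain ⟨-, -, hEq⟩ := rootEnergy_ins_copy hδ hs hμ (hI μ hμ).1 hμV hμA
    show rootEnergy lennardJones ((I μ).map fun z => z - u) = _
    rw [(hI μ hμ).2, hEq]
  have hintJ : Integrable (fun μ => rootEnergy lennardJones (J μ)) (P.restrict A) :=
    (integrable_map_measure hintJ0.aestronglyMeasurable hJm.aemeasurable).1 hintJ0
  have hintΦA : Integrable (fun μ => (∫ z, lennardJones ‖z - u‖ ∂μ) / 2) (P.restrict A) := by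
    have h := (hintΦ.restrict (s := A)).div_const 2
    refine h.congr ?_
    filter_upwards [ae_restrict_mem hA] with μ hμA
    simp only [Set.indicator_of_mem hμA]
  have hintM : Integrable (fun μ => (∫ z, lennardJones ‖z‖ ∂(μ.restrict {p : E3 | μ.map (fun x : E3 => x - p) ∈ A})) / 2) (P.restrict A) :=
    ((hintJ.congr hcopy_ae).sub hintΦA).congr (Filter.Eventually.of_forall fun μ => add_sub_cancel_left _ _)
  have hintM' : Integrable (fun μ => ∫ z, lennardJones ‖z‖ ∂(μ.restrict {p : E3 | μ.map (fun x : E3 => x - p) ∈ A})) (P.restrict A) :=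
    (hintM.const_mul 2).congr (Filter.Eventually.of_forall fun μ =>
      (by ring : 2 * ((∫ z, lennardJones ‖z‖ ∂(μ.restrict {p : E3 | μ.map (fun x : E3 => x - p) ∈ A})) / 2) =
        ∫ z, lennardJones ‖z‖ ∂(μ.restrict {p : E3 | μ.map (fun x : E3 => x - p) ∈ A})))
  refine ⟨hintM', ?_⟩
  have hEJ : ∫ μ in A, rootEnergy lennardJones
      ((μ + (μ.restrict {p : E3 | μ.map (fun x : E3 => x - p) ∈ A}).map (fun z => z + u)).map (fun z => z - u)) ∂P =
      (∫ μ in A, ∫ z, lennardJones ‖z - u‖ ∂μ ∂P) / 2 +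
        (∫ μ in A, ∫ z, lennardJones ‖z‖ ∂(μ.restrict {p : E3 | μ.map (fun x : E3 => x - p) ∈ A}) ∂P) / 2 := by
    have e1 : ∫ μ in A, rootEnergy lennardJones
        ((μ + (μ.restrict {p : E3 | μ.map (fun x : E3 => x - p) ∈ A}).map (fun z => z + u)).map (fun z => z - u)) ∂P =
        ∫ μ in A, rootEnergy lennardJones (J μ) ∂P :=
      integral_congr_ae ((ae_restrict_of_ae (s := A) hcore).mono fun μ hμ => by
        show _ = rootEnergy lennardJones ((I μ).map fun z => z - u); rw [(hI μ hμ).2])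
    rw [e1, integral_congr_ae hcopy_ae, integral_add hintΦA hintM, integral_div, integral_div]
  rw [hEJ] at hprice
  linarith

end Summit.AtomisticToContinuum.Crystallization.Theorems.FrustratedLawDichotomyThickening

end
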